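import Literature.AlgebraicGeometry.Resolution.HenselianRationalityPerfectSplit
import HarnessLib

/-!
# The henselian generator can be taken in a dense subfield (Kuhlmann–Vlahu 2014, Thm. 11.1, `γ`-clause)

Topic: `Literature/AlgebraicGeometry/Resolution` (valued function fields). F.-V. Kuhlmann,
I. Vlahu, *The relative approximation degree in valued function fields*, Math. Z. 276 (2014) =
arXiv:1304.0200, **Thm. 11.1**:

> Take a valued field `(K,v)` of rank 1 and an immediate function field `(F|K,v)` of
> transcendence degree 1. Suppose there is some `x ∈ F^h ∖ K^c` with transcendental
> approximation type over `K` such that `F^h = K(x)^h`. Then there is already some `y ∈ F` such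
> that `F^h = K(y)^h`. **In fact, there is some `γ ∈ vK` such that `K(x)^h = K(y)^h` holds for
> every `y ∈ F` with `v(x-y) ≥ γ`.**

The tree proves the first sentence over a perfect henselian ground field algebraically closed in
`F^h` (`kuhlmannVlahu_thm111_of_perfect`, `HenselianRationalityPerfectSplit.lean`, following
Kuhlmann 2019, Prop. 5.2). This file PROVES the use of the second sentence (the `γ`-clause) that
the assembly of M. Temkin, *Inseparable local uniformization*, J. Algebra 373 (2013), Thm. 3.3.1
needs (tree: `Temkin2013RelativeCurveSmoothFibre.of_inputs`, hypothesis (J1): the henselian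
generator `t` must lie in `K₁·k(S)`, i.e. BEFORE the separable constants are adjoined; in the
source this is "`T ∈ 𝒜 ⊗_k k_p` … hence we can move `T`", proof of Thm. 3.2.6, Step 2, p. 43 of
arXiv:0804.1554v3): **the generator `y` can be taken in any subfield `D ≤ F` which is dense in
`F` (`F ≤ D^h`), contains a separating element of `F|K` and contains arbitrarily small non-zero
elements of `K`.** Same proof as `kuhlmannVlahu_thm111_of_perfect` (the candidates `y₀`,
`y₀ + a·z` are now taken with `y₀, z ∈ D`, `a ∈ K ∩ D`), which it generalizes (`D = F`).

* `kuhlmannVlahu_thm111_of_perfect_of_dense` — PROVED.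

No definitions, no named facts.

## Sources

* F.-V. Kuhlmann, I. Vlahu, Math. Z. 276 (2014) = arXiv:1304.0200, Thm. 11.1 (with §10).
  [KuhlmannVlahu2014]
* F.-V. Kuhlmann, Israel J. Math. 234 (2019) = arXiv:1701.05508, Prop. 5.2 (proof), Thm. 2.3.
  [Kuhlmann2019]
* M. Temkin, arXiv:0804.1554v3, Thm. 3.2.6 (proof, Step 2), Thm. 3.3.1. [Temkin2013]
-/

noncomputable section

namespace Literature.AlgebraicGeometry.Resolution

universe u

open Polynomial IsLocalRing IntermediateField

variable {Ω : Type u} [Field Ω] (V : ValuationSubring Ω)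

/-- **Kuhlmann–Vlahu 2014, Thm. 11.1 (with its `γ`-clause), over a perfect henselian ground field
of rank one algebraically closed in `F^h`: the generator in a dense subfield.** Let `K ≤ F ≤ Ω`
(`Ω` algebraically closed of characteristic `p`, valuation ring `V` of residue characteristic
`p`), `K` perfect, henselian, of rank one, `F|K` finitely generated of transcendence degree `1`
and immediate, every element of `F^h` algebraic over `K` lying in `K`; let `D ≤ F` be a subfield
with `F ≤ D^h`, containing a separating element `z` of `F|K` and, below every non-zero value of
`K`, a non-zero element of `K ∩ D`. If `F ≤ K(x)^h` for some `x ∈ F^h` transcendental over `K`,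
then `F ≤ K(y)^h` for some `y ∈ D` transcendental over `K`.
[cite: KuhlmannVlahu2014, Thm. 11.1] [cite: Kuhlmann2019, Prop. 5.2 (proof) with Thm. 2.3] -/
theorem kuhlmannVlahu_thm111_of_perfect_of_dense [IsAlgClosed Ω] (p : ℕ) [Fact p.Prime]
    [CharP Ω p] [CharP (ResidueField V) p] (K F D : Subfield Ω) (x : Ω)
    (hK : IsHenselianField K (V.comap (algebraMap K Ω))) (hperf : ∀ y ∈ K, ∃ b ∈ K, b ^ p = y)
    (hr : IsRankOne V K) (hKF : K ≤ F) (hfg : FGOver K F)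
    (himm : IsImmediateOver V K F)
    (hrel : ∀ a ∈ henselization V F, IsAlgebraic K a → a ∈ K)
    (hDF : D ≤ F) (hFD : F ≤ henselization V D)
    (hsmall : ∀ e ∈ K, e ≠ 0 → ∃ d ∈ K, d ∈ D ∧ d ≠ 0 ∧ V.valuation d < V.valuation e)
    (hsepD : ∃ z ∈ D, Transcendental K z ∧
      ∀ w ∈ F, IsSeparable (Subfield.closure ((K : Set Ω) ∪ {z})) w)
    (hxFh : x ∈ henselization V F) (hxt : Transcendental K x)
    (hFx : F ≤ henselization V (Subfield.closure ((K : Set Ω) ∪ {x}))) :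
    ∃ y ∈ D, Transcendental K y ∧
      F ≤ henselization V (Subfield.closure ((K : Set Ω) ∪ {y})) := by
  classical
  set Kx : Subfield Ω := Subfield.closure ((K : Set Ω) ∪ {x}) with hKxdef
  set Hx : Subfield Ω := henselization V Kx with hHxdef
  set Fh : Subfield Ω := henselization V F with hFhdef
  have hKKx : K ≤ Kx := fun c hc => Subfield.subset_closure (Or.inl hc)
  have hxKx : x ∈ Kx := Subfield.subset_closure (Or.inr rfl)
  have hFFh : F ≤ Fh := le_henselization V F
  have hKxFh : Kx ≤ Fh :=
    Subfield.closure_le.mpr (Set.union_subset (hKF.trans hFFh) (Set.singleton_subset_iff.mpr hxFh))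
  -- immediateness of `F^h`, `K(x)` over `K`; rank one
  have himmFh : IsImmediateOver V K Fh := himm.trans (Kuhlmann2010HenselizationImmediate_holds Ω V F)
  have himmKx : IsImmediateOver V K Kx := himmFh.mono_right hKxFh
  have hKr : IsRankOneValued V K := isRankOneValued_of_overrings V K hr.1 hr.2
  have hFr : IsRankOneValued V F := hKr.of_isImmediateOver hKF himm
  -- `x ∉ K`, immediateness data, transcendental approximation type
  have htrans : ∀ P : Polynomial Ω, (∀ k, P.coeff k ∈ K) → P.eval x = 0 → P = 0 := by
    intro P hP hPx
    obtain ⟨P', hP'⟩ : ∃ P' : Polynomial K, P'.map (algebraMap K Ω) = P :=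
      (Polynomial.mem_lifts P).mp ((Polynomial.lifts_iff_coeff_lifts P).mpr
        fun k => ⟨⟨P.coeff k, hP k⟩, rfl⟩)
    by_contra hP0
    refine hxt ⟨P', fun h => hP0 ?_, ?_⟩
    · rw [← hP', h, Polynomial.map_zero]
    · rw [Polynomial.aeval_def, ← Polynomial.eval_map, hP', hPx]
  have hxK : x ∉ K := not_mem_of_forall_eval_eq_zero K htrans
  have hval : ∀ w ∈ Kx, w ≠ 0 → ∃ b ∈ K, V.valuation w = V.valuation b := himmKx.1
  have hres : ∀ w ∈ Kx, w ∈ V → ∃ c ∈ K, V.valuation (w - c) < 1 := by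
    intro w hw hwV
    have hrw : residue V ⟨w, hwV⟩ ∈ resField V K := himmKx.2 (residue_mem_resField V ⟨w, hwV⟩ hw)
    obtain ⟨c, hcK, hcw⟩ := (mem_resField_iff V K _).mp hrw
    refine ⟨c, hcK, ?_⟩
    have h0 : residue V (⟨w, hwV⟩ - c) = 0 := by rw [map_sub, hcw, sub_self]
    exact (ValuationSubring.valuation_lt_one_iff V (⟨w, hwV⟩ - c)).mp ((residue_eq_zero_iff _).mp h0)
  -- `F^h` is henselian and `K`-split (Temkin 2013, Cor. 3.1.10); transcendental approximation type
  have hFh : IsHenselianField Fh (V.comap (algebraMap Fh Ω)) :=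
    Kuhlmann2010HenselizationIsHenselian_holds Ω V F
  have hsplit : ∀ θ g : Ω, IsAlgebraic K θ → IsAlgebraic K g →
      (∀ c ∈ K, V.valuation g ≤ V.valuation (x - c)) → V.valuation g ≤ V.valuation (x - θ) :=
    fun θ g hθ hg hfar' =>
      valuation_le_sub_of_forall_isAlgebraic_mem_of_perfect V p (hKF.trans hFFh) hK hperf hKr hFh
        hrel hxFh hθ hg hfar'
  have h3 := kaplansky_condition_of_split V K htrans himmKx hsplit
  have hr1Kx : IsRankOneValued V Kx := hKr.of_isImmediateOver hKKx himmKx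
  -- `D` is dense in `F^h` and has rank one
  have hDh : IsHenselianField (henselization V D) (V.comap (algebraMap (henselization V D) Ω)) :=
    Kuhlmann2010HenselizationIsHenselian_holds Ω V D
  have hFhDh : Fh ≤ henselization V D := henselization_le_of_isHenselianField V F hFD hDh
  have hDr : IsRankOneValued V D := by
    refine hFr.of_le hDF ?_
    obtain ⟨d, -, hdD, hd0, hd1⟩ := hsmall 1 K.one_mem one_ne_zero
    rw [map_one] at hd1
    exact ⟨d⁻¹, inv_mem hdD, by rw [map_inv₀]; exact one_lt_inv_iff₀.mpr ⟨(Valuation.pos_iff _).mpr hd0, hd1⟩⟩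
  -- a separating transcendental `z ∈ D`
  obtain ⟨z, hzD, hz, hsepz⟩ := hsepD
  have hzF : z ∈ F := hDF hzD
  /- The core: for `y ∈ F` separating, transcendental, and — unless `x` is a limit of elements of
  `K` — closer to `x` than `K`, we get `F ≤ K(y)^h`. (Verbatim from
  `kuhlmannVlahu_thm111_of_perfect`.) -/
  have core : ∀ y ∈ F, Transcendental K y →
      (∀ w ∈ F, IsSeparable (Subfield.closure ((K : Set Ω) ∪ {y})) w) →
      ((∀ e ∈ K, e ≠ 0 → ∃ c ∈ K, V.valuation (x - c) < V.valuation e) ∨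
        ∃ e ∈ K, e ≠ 0 ∧ (∀ c ∈ K, V.valuation e ≤ V.valuation (x - c)) ∧
          V.valuation (x - y) < V.valuation e) →
      F ≤ henselization V (Subfield.closure ((K : Set Ω) ∪ {y})) := by
    intro y hyF _hyt hsepy hcase
    set Ky : Subfield Ω := Subfield.closure ((K : Set Ω) ∪ {y}) with hKydef
    set L : Subfield Ω := henselization V Ky with hLdef
    have hKKy : K ≤ Ky := fun c hc => Subfield.subset_closure (Or.inl hc)
    have hyKy : y ∈ Ky := Subfield.subset_closure (Or.inr rfl)
    have hKyF : Ky ≤ F :=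
      Subfield.closure_le.mpr (Set.union_subset hKF (Set.singleton_subset_iff.mpr hyF))
    have hKyL : Ky ≤ L := le_henselization V Ky
    have hKL : K ≤ L := hKKy.trans hKyL
    have hL : IsHenselianField L (V.comap (algebraMap L Ω)) :=
      Kuhlmann2010HenselizationIsHenselian_holds Ω V Ky
    have himmL : IsImmediateOver V Ky L := Kuhlmann2010HenselizationImmediate_holds Ω V Ky
    -- `x` is separable over `L`
    have hsepKy : IsSeparable Ky x :=
      isSeparable_trans_subfield hKyF hsepy (isSeparable_of_mem_henselization V F hxFh)
    have hsepL : IsSeparable L x := isSeparable_of_subfield_le hKyL hsepKy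
    -- `x` is a limit of elements of `L`
    have happrox : ∀ e' ∈ L, e' ≠ 0 → ∃ ℓ ∈ L, V.valuation (x - ℓ) < V.valuation e' := by
      intro e' he'L he'0
      -- `e₁ ∈ K^×` with `v(e₁) = v(e')`
      obtain ⟨e₂, he₂Ky, he₂⟩ := himmL.1 e' he'L he'0
      have he₂0 : e₂ ≠ 0 := fun h => he'0 (by
        rw [h, map_zero] at he₂; exact (Valuation.zero_iff _).mp he₂)
      obtain ⟨e₁, he₁K, he₁⟩ := himm.1 e₂ (hKyF he₂Ky) he₂0
      have he₁0 : e₁ ≠ 0 := fun h => he₂0 (by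
        rw [h, map_zero] at he₁; exact (Valuation.zero_iff _).mp he₁)
      rw [he₂, he₁]
      rcases hcase with hA | ⟨e, heK, he0, hefar, hey⟩
      · obtain ⟨c, hcK, hc⟩ := hA e₁ he₁K he₁0
        exact ⟨c, hKL hcK, hc⟩
      · -- the Newton step: approximate `y` by `f(x)`, `f ∈ K[X]`, to within `min(v e, v e₁)`
        obtain ⟨d, hdK, hd0, hde, hde₁⟩ : ∃ d ∈ K, d ≠ 0 ∧ V.valuation d ≤ V.valuation e ∧
            V.valuation d ≤ V.valuation e₁ := by
          by_cases h : V.valuation e₁ ≤ V.valuation e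
          · exact ⟨e₁, he₁K, he₁0, h, le_rfl⟩
          · exact ⟨e, heK, he0, le_rfl, (not_le.mp h).le⟩
        obtain ⟨f, hf, hfy⟩ := exists_polynomial_valuation_sub_lt_of_mem_henselization V K hxK
          hval hres h3 hr1Kx (hFx hyF) (hKKx hdK) hd0
        have hy' : ∀ c ∈ K, V.valuation (x - y) < V.valuation (x - c) := fun c hc =>
          lt_of_lt_of_le hey (hefar c hc)
        have hfy' : ∀ c ∈ K, V.valuation (f.eval x - y) < V.valuation (x - c) := fun c hc => by
          rw [Valuation.map_sub_swap]
          exact lt_of_lt_of_le hfy (hde.trans (hefar c hc))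
        obtain ⟨ℓ, hℓL, hℓ⟩ := exists_mem_valuation_sub_le_of_taylor V K hxK hval hres h3 hL hKL
          (hKyL hyKy) hy' hf hfy'
        refine ⟨ℓ, hℓL, lt_of_le_of_lt hℓ ?_⟩
        rw [Valuation.map_sub_swap]
        exact lt_of_lt_of_le hfy hde₁
    -- Krasner: `x ∈ L`; hence `K(x)^h ≤ L` and `F ≤ L`
    have hxL : x ∈ L := mem_of_isHenselianField_of_forall_exists_valuation_sub_lt V hL hsepL happrox
    have hKxL : Kx ≤ L :=
      Subfield.closure_le.mpr (Set.union_subset hKL (Set.singleton_subset_iff.mpr hxL))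
    have hHxL : Hx ≤ L := henselization_le_of_isHenselianField V Kx hKxL hL
    exact hFx.trans hHxL
  /- Case distinction: is `x` a limit of elements of `K`? -/
  by_cases hA : ∀ e ∈ K, e ≠ 0 → ∃ c ∈ K, V.valuation (x - c) < V.valuation e
  · exact ⟨z, hzD, hz, core z hzF hz hsepz (Or.inl hA)⟩
  push Not at hA
  obtain ⟨e, heK, he0, hefar⟩ := hA
  -- `y₀ ∈ D` close to `x` (density of `D` in `F^h ≤ D^h`) and a small separating `z₁ = a z`
  obtain ⟨d₀, -, hd₀D, hd₀0, hd₀e⟩ := hsmall e heK he0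
  obtain ⟨y₀, hy₀D, hy₀'⟩ :=
    exists_mem_valuation_sub_lt_of_isRankOneValued hDr (hFhDh hxFh) hd₀D hd₀0
  have hy₀ : V.valuation (x - y₀) < V.valuation e := hy₀'.trans hd₀e
  have hy₀F : y₀ ∈ F := hDF hy₀D
  have hz0 : z ≠ 0 := fun h => hz (h ▸ isAlgebraic_zero)
  obtain ⟨z', hz'K, hzz'⟩ := himm.1 z hzF hz0
  have hz'0 : z' ≠ 0 := fun h => hz0 (by
    rw [h, map_zero] at hzz'; exact (Valuation.zero_iff _).mp hzz')
  obtain ⟨a, haK, haD, ha0, ha⟩ := hsmall (e * z'⁻¹) (mul_mem heK (inv_mem hz'K))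
    (mul_ne_zero he0 (inv_ne_zero hz'0))
  set z₁ : Ω := a * z with hz₁def
  have hz₁D : z₁ ∈ D := mul_mem haD hzD
  have hz₁F : z₁ ∈ F := hDF hz₁D
  have hvz₁ : V.valuation z₁ < V.valuation e := by
    have hvz' : V.valuation z' ≠ 0 := (_root_.map_ne_zero _).mpr hz'0
    have h1 : V.valuation z₁ = V.valuation a * V.valuation z' := by
      rw [hz₁def, map_mul, hzz']
    have h2 : V.valuation e = V.valuation (e * z'⁻¹) * V.valuation z' := by
      rw [map_mul, map_inv₀, inv_mul_cancel_right₀ hvz']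
    rw [h1, h2]
    exact mul_lt_mul_of_pos_right ha ((Valuation.pos_iff _).mpr hz'0)
  have hz₁ : Transcendental K z₁ := by
    refine transcendental_of_mem_closure K hz ?_ fun hz₁K => ?_
    · exact mul_mem (Subfield.subset_closure (Or.inl haK)) (Subfield.subset_closure (Or.inr rfl))
    · have hzK : z ∈ K := by
        have : z = a⁻¹ * z₁ := by rw [hz₁def, ← mul_assoc, inv_mul_cancel₀ ha0, one_mul]
        rw [this]; exact mul_mem (inv_mem haK) hz₁K
      exact hz (isAlgebraic_algebraMap (⟨z, hzK⟩ : K))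
  have hsepz₁ : ∀ b ∈ F, IsSeparable (Subfield.closure ((K : Set Ω) ∪ {z₁})) b := by
    rw [hz₁def, closure_insert_mul_eq K haK ha0 z]
    exact hsepz
  -- both candidates `y₀`, `y₀ + z₁` are within `v(e)` of `x`, hence transcendental
  have hy₁ : V.valuation (x - (y₀ + z₁)) < V.valuation e := by
    have : x - (y₀ + z₁) = (x - y₀) + -z₁ := by ring
    rw [this]
    refine lt_of_le_of_lt (Valuation.map_add _ _ _) (max_lt hy₀ ?_)
    rw [Valuation.map_neg]; exact hvz₁
  have hfar₀ : ∀ c ∈ K, V.valuation (x - y₀) < V.valuation (x - c) := fun c hc =>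
    lt_of_lt_of_le hy₀ (hefar c hc)
  have hfar₁ : ∀ c ∈ K, V.valuation (x - (y₀ + z₁)) < V.valuation (x - c) := fun c hc =>
    lt_of_lt_of_le hy₁ (hefar c hc)
  -- (an algebraic element of `F` closer to `x` than `K` would lie in `K`: splitness)
  have htr : ∀ y ∈ F, (∀ c ∈ K, V.valuation (x - y) < V.valuation (x - c)) → Transcendental K y :=
    fun y hyF hfar' hyalg => lt_irrefl _ (hfar' y (hrel y (hFFh hyF) hyalg))
  have hy₀t : Transcendental K y₀ := htr y₀ hy₀F hfar₀
  have hy₁t : Transcendental K (y₀ + z₁) := htr (y₀ + z₁) (add_mem hy₀F hz₁F) hfar₁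
  -- one of them is separating
  have hsep_or : (∀ w ∈ F, IsSeparable (Subfield.closure ((K : Set Ω) ∪ {y₀})) w) ∨
      (∀ w ∈ F, IsSeparable (Subfield.closure ((K : Set Ω) ∪ {y₀ + z₁})) w) :=
    separating_or_separating_add p hKF hfg hz₁ hz₁F hsepz₁ hy₀F hy₀t hy₁t
  rcases hsep_or with hsep₀ | hsep₁
  · exact ⟨y₀, hy₀D, hy₀t, core y₀ hy₀F hy₀t hsep₀ (Or.inr ⟨e, heK, he0, hefar, hy₀⟩)⟩
  · exact ⟨y₀ + z₁, add_mem hy₀D hz₁D, hy₁t,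
      core (y₀ + z₁) (add_mem hy₀F hz₁F) hy₁t hsep₁ (Or.inr ⟨e, heK, he0, hefar, hy₁⟩)⟩

end Literature.AlgebraicGeometry.Resolution

end
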